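import Mathlib
import Literature.Probability.LatticeModels.GKSInequalities
import Summits.CriticalPhenomena.Ising3DConformalLimit.Theorems.PrecisionLaplacianInverseMFerromagnetImOfImDeg3
import Summits.CriticalPhenomena.Ising3DConformalLimit.Theorems.PrecisionLaplacianInverseMFerromagnetSpSubdivideAux2
import HarnessLib

/-!
# Crux `PrecisionLaplacian.InverseMFerromagnet` (stmt-CriticalPhenomena-4798), line `Sketch` —
# auxiliary lemmas (part 3, the triangle system) for stub `helper_sp_subdivide` (T-SP·3)

THEOREM-ONLY helper file (no definitions).  THE TRIANGLE SYSTEM `T`: sites `Fin N`, three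
distinguished sites `x, y, z`, a finite set `B ∋ x, y, z`, a pair system `(K', C')` all of whose
bonds inside `B` are `{x,y}`, `{x,z}` or `{z,y}`, and `J ≥ 0`.  `T` has bond index `ι ⊕ Unit`:
the bonds of `C'` inside `B` keep their coupling, the bonds not inside `B` get coupling `0` and the
harmless support `{z, y}`, and the extra bond (index `inr ()`) is `{x, y}` with coupling `J` — this
is (up to the supports of the zero-coupling bonds, which do not matter) the effective system of
`helper_marginal_twoSep` (ii) for the side `B`.  We prove:

* supports and total couplings of `T` (`spSub_T_supports`, `spSub_T_coupling`);
* `⟨σ_xσ_y⟩_T = tanh (K₁ + J + K''(u, w))` (`spSub_T_rho`; `K₁, u, w` the total couplings of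
  `(K', C')` on `{x,y}, {x,z}, {z,y}`; `spSub_triangle_corr`);
* the sites outside `B` are free in `T`, so `(Σ_T⁻¹)_xy = ((Σ_T)_BB⁻¹)_xy`
  (`spSub_inv_entry_block`), and `x` has "degree two" in `T`, so
  `(Σ_T⁻¹)_xy = −t/(1 + t² − 2t⟨σ_xσ_y⟩_T)` with `t = tanh (K₁ + J)` (`spSub_db_deg2_eq_gen`):
  `spSub_T_Q`.
-/

namespace Summit.CriticalPhenomena.Ising3DConformalLimit.Cruxes.InverseMFerromagnet.PartialCovarianceLadder

open Literature.Probability.LatticeModels Finset Matrix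

/-- The supports of the triangle system are `{x,y}`, `{x,z}` or `{z,y}`. [folklore] -/
theorem spSub_T_supports {N : ℕ} {ι : Type*} (C' : ι → Finset (Fin N)) {x y z : Fin N}
    (B : Finset (Fin N)) (hB : ∀ j, C' j ⊆ B → C' j = {x, y} ∨ C' j = {x, z} ∨ C' j = {z, y})
    (CT : ι ⊕ Unit → Finset (Fin N))
    (hCT : CT = Sum.elim (fun i => if C' i ⊆ B then C' i else {z, y}) (fun _ => {x, y}))
    (j : ι ⊕ Unit) : CT j = {x, y} ∨ CT j = {x, z} ∨ CT j = {z, y} := by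
  subst hCT
  rcases j with i | _
  · simp only [Sum.elim_inl]
    by_cases h : C' i ⊆ B
    · rw [if_pos h]; exact hB i h
    · rw [if_neg h]; exact Or.inr (Or.inr rfl)
  · exact Or.inl rfl

/-- Total couplings of the triangle system on a pair `e ⊆ B`: those of `(K', C')`, plus `J` on
`{x, y}`. [folklore] -/
theorem spSub_T_coupling {N : ℕ} {ι : Type*} [Fintype ι] (K' : ι → ℝ) (C' : ι → Finset (Fin N))
    {x y z : Fin N} (B : Finset (Fin N)) (J : ℝ) (KT : ι ⊕ Unit → ℝ)
    (hKT : KT = Sum.elim (fun i => if C' i ⊆ B then K' i else 0) (fun _ => J))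
    (CT : ι ⊕ Unit → Finset (Fin N))
    (hCT : CT = Sum.elim (fun i => if C' i ⊆ B then C' i else {z, y}) (fun _ => {x, y}))
    (e : Finset (Fin N)) (he : e ⊆ B) :
    ∑ j ∈ Finset.univ.filter (fun j => CT j = e), KT j
      = (∑ i ∈ Finset.univ.filter (fun i => C' i = e), K' i)
        + (if ({x, y} : Finset (Fin N)) = e then J else 0) := by
  classical
  subst hKT hCT
  rw [Finset.sum_filter, Finset.sum_filter, Fintype.sum_sum_type, Fintype.sum_unique (ι := Unit)]
  simp only [Sum.elim_inl, Sum.elim_inr]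
  congr 1
  refine Finset.sum_congr rfl fun i _ => ?_
  by_cases h : C' i ⊆ B
  · simp only [if_pos h]
  · simp only [if_neg h]
    rw [if_neg (fun h' : C' i = e => h (h'.symm ▸ he))]
    split_ifs <;> rfl

/-- **The separator correlation of the triangle system**:
`⟨σ_xσ_y⟩_T = tanh (K₁ + J + ½ log (cosh (u+w)/cosh (u−w)))`. [folklore] -/
theorem spSub_T_rho {N : ℕ} {ι : Type*} [Fintype ι] (K' : ι → ℝ) (C' : ι → Finset (Fin N))
    {x y z : Fin N} (hxy : x ≠ y) (hxz : x ≠ z) (hzy : z ≠ y) (B : Finset (Fin N)) (hx : x ∈ B)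
    (hy : y ∈ B) (hz : z ∈ B)
    (hB : ∀ j, C' j ⊆ B → C' j = {x, y} ∨ C' j = {x, z} ∨ C' j = {z, y}) (J : ℝ)
    (KT : ι ⊕ Unit → ℝ) (hKT : KT = Sum.elim (fun i => if C' i ⊆ B then K' i else 0) (fun _ => J))
    (CT : ι ⊕ Unit → Finset (Fin N))
    (hCT : CT = Sum.elim (fun i => if C' i ⊆ B then C' i else {z, y}) (fun _ => {x, y})) :
    gksExpect Finset.univ KT CT (fun ω => spinAt x ω * spinAt y ω)
      = Real.tanh ((∑ i ∈ Finset.univ.filter (fun i => C' i = {x, y}), K' i) + J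
          + Real.log (Real.cosh ((∑ i ∈ Finset.univ.filter (fun i => C' i = {x, z}), K' i)
                + ∑ i ∈ Finset.univ.filter (fun i => C' i = {z, y}), K' i)
              / Real.cosh ((∑ i ∈ Finset.univ.filter (fun i => C' i = {x, z}), K' i)
                - ∑ i ∈ Finset.univ.filter (fun i => C' i = {z, y}), K' i)) / 2) := by
  classical
  have hxyB : ({x, y} : Finset (Fin N)) ⊆ B := by
    intro r hr; simp only [Finset.mem_insert, Finset.mem_singleton] at hr
    rcases hr with rfl | rfl <;> assumption
  have hxzB : ({x, z} : Finset (Fin N)) ⊆ B := by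
    intro r hr; simp only [Finset.mem_insert, Finset.mem_singleton] at hr
    rcases hr with rfl | rfl <;> assumption
  have hzyB : ({z, y} : Finset (Fin N)) ⊆ B := by
    intro r hr; simp only [Finset.mem_insert, Finset.mem_singleton] at hr
    rcases hr with rfl | rfl <;> assumption
  have n12 : ({x, y} : Finset (Fin N)) ≠ {x, z} := by
    intro he
    have hm : y ∈ ({x, z} : Finset (Fin N)) := by rw [← he]; simp
    simp only [Finset.mem_insert, Finset.mem_singleton] at hm
    rcases hm with hm | hm
    · exact hxy hm.symm
    · exact hzy hm.symm
  have n13 : ({x, y} : Finset (Fin N)) ≠ {z, y} := by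
    intro he
    have hm : x ∈ ({z, y} : Finset (Fin N)) := by rw [← he]; simp
    simp only [Finset.mem_insert, Finset.mem_singleton] at hm
    rcases hm with hm | hm
    · exact hxz hm
    · exact hxy hm
  rw [spSub_triangle_corr KT CT hxy hxz hzy (spSub_T_supports C' B hB CT hCT),
    spSub_T_coupling K' C' B J KT hKT CT hCT _ hxyB, spSub_T_coupling K' C' B J KT hKT CT hCT _ hxzB,
    spSub_T_coupling K' C' B J KT hKT CT hCT _ hzyB, if_pos rfl, if_neg n12, if_neg n13, add_zero,
    add_zero]

/-- **The inverse of the triangle system at `(x, y)`**: the sites outside `B` are free, so the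
entry is that of the inverse of the `B`-block; and `x` has degree two (bonds `{x,z}`, `{x,y}`), so
DB♯ is an equality there: `(Σ_T⁻¹)_xy = −t/(1 + t² − 2t⟨σ_xσ_y⟩_T)`, `t = tanh (K₁ + J)`.
[folklore] -/
theorem spSub_T_Q {N : ℕ} {ι : Type*} [Fintype ι] (K' : ι → ℝ) (C' : ι → Finset (Fin N))
    (hK' : ∀ i, 0 ≤ K' i) {x y z : Fin N} (hxy : x ≠ y) (hxz : x ≠ z) (hzy : z ≠ y)
    (B : Finset (Fin N)) (hx : x ∈ B) (hy : y ∈ B) (hz : z ∈ B)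
    (hB : ∀ j, C' j ⊆ B → C' j = {x, y} ∨ C' j = {x, z} ∨ C' j = {z, y}) (J : ℝ) (hJ : 0 ≤ J)
    (KT : ι ⊕ Unit → ℝ) (hKT : KT = Sum.elim (fun i => if C' i ⊆ B then K' i else 0) (fun _ => J))
    (CT : ι ⊕ Unit → Finset (Fin N))
    (hCT : CT = Sum.elim (fun i => if C' i ⊆ B then C' i else {z, y}) (fun _ => {x, y})) :
    (Matrix.of fun p q : Fin N => gksExpect Finset.univ KT CT (fun ω => spinAt p ω * spinAt q ω))⁻¹ x y
        = ((Matrix.of fun p q : Fin N =>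
            gksExpect Finset.univ KT CT (fun ω => spinAt p ω * spinAt q ω)).submatrix
              (Subtype.val : ↥B → Fin N) (Subtype.val : ↥B → Fin N))⁻¹ ⟨x, hx⟩ ⟨y, hy⟩ ∧
      (Matrix.of fun p q : Fin N => gksExpect Finset.univ KT CT (fun ω => spinAt p ω * spinAt q ω))⁻¹ x y
        = -(Real.tanh ((∑ i ∈ Finset.univ.filter (fun i => C' i = {x, y}), K' i) + J)) /
          (1 + Real.tanh ((∑ i ∈ Finset.univ.filter (fun i => C' i = {x, y}), K' i) + J) ^ 2
            - 2 * Real.tanh ((∑ i ∈ Finset.univ.filter (fun i => C' i = {x, y}), K' i) + J)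
              * gksExpect Finset.univ KT CT (fun ω => spinAt x ω * spinAt y ω)) := by
  classical
  have hsupp := spSub_T_supports C' B hB CT hCT
  have hxyB : ({x, y} : Finset (Fin N)) ⊆ B := by
    intro r hr; simp only [Finset.mem_insert, Finset.mem_singleton] at hr
    rcases hr with rfl | rfl <;> assumption
  -- every support of `T` lies inside `B`
  have hCTB : ∀ j, CT j ⊆ B := by
    intro j r hr
    rcases hsupp j with h | h | h <;> rw [h] at hr <;>
      simp only [Finset.mem_insert, Finset.mem_singleton] at hr <;> rcases hr with rfl | rfl <;>
      assumption
  -- nonnegative couplings, two-site supports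
  have hKT0 : ∀ j, 0 ≤ KT j := by
    intro j; subst hKT
    rcases j with i | _
    · simp only [Sum.elim_inl]; split_ifs; exacts [hK' i, le_rfl]
    · exact hJ
  have hCT2 : ∀ j, (CT j).card = 2 := by
    intro j
    rcases hsupp j with h | h | h <;> rw [h]
    exacts [Finset.card_pair hxy, Finset.card_pair hxz, Finset.card_pair hzy]
  -- the sites outside `B` are free
  set M : Matrix (Fin N) (Fin N) ℝ :=
    Matrix.of fun p q : Fin N => gksExpect Finset.univ KT CT (fun ω => spinAt p ω * spinAt q ω)
    with hM
  have hfree : ∀ p, p ∉ B → ∀ k, k ≠ p → M p k = 0 := by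
    intro p hp k hk
    simp only [hM, Matrix.of_apply]
    exact c2_free KT CT p (fun j hj => absurd (hCTB j hj) hp) (spinAt k)
      (fun ω => pcm2im_spinAt_flip_ne hk ω)
  refine ⟨spSub_inv_entry_block M (c5_posDef Finset.univ KT CT) B hfree hx hy, ?_⟩
  -- degree two at `x`
  have hdeg : ∀ j, x ∈ CT j → (CT j = {x, z} ∨ CT j = {x, y}) := by
    intro j hj
    rcases hsupp j with h | h | h
    · exact Or.inr h
    · exact Or.inl h
    · rw [h] at hj
      simp only [Finset.mem_insert, Finset.mem_singleton] at hj
      rcases hj with hj | hj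
      · exact absurd hj hxz
      · exact absurd hj hxy
  rw [hM, spSub_db_deg2_eq_gen KT CT hKT0 hCT2 x z y hxy hxz hzy hdeg,
    spSub_T_coupling K' C' B J KT hKT CT hCT _ hxyB, if_pos rfl]

/-! ## The old block of the subdivided second-moment matrix -/

/-- **The old block.**  The block of the second-moment matrix of the subdivided system on the old
sites `A = univ.erase ℓ` is (re-indexed by `castSucc`) the second-moment matrix of the OLD
structure with the series coupling `K''` on `i₀` (`spSub_marginal`); hence so are the inverses
(`Matrix.inv_submatrix_equiv`). [folklore] -/
theorem spSub_Ablock {n m : ℕ} (C : Fin m → Finset (Fin n)) (i₀ : Fin m) (a b : Fin n)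
    (hab : a ≠ b) (hCi₀ : C i₀ = {a, b}) (C' : Fin (m + 1) → Finset (Fin (n + 1)))
    (hC'1 : ∀ i : Fin m, i ≠ i₀ → C' i.castSucc = (C i).map Fin.castSuccEmb)
    (hC'2 : C' i₀.castSucc = {a.castSucc, Fin.last n})
    (hC'3 : C' (Fin.last m) = {Fin.last n, b.castSucc}) (K' : Fin (m + 1) → ℝ) (Kpp : ℝ)
    (hKpp : Kpp = Real.log (Real.cosh (K' i₀.castSucc + K' (Fin.last m))
      / Real.cosh (K' i₀.castSucc - K' (Fin.last m))) / 2)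
    (G : Matrix (Fin (n + 1)) (Fin (n + 1)) ℝ)
    (hG : G = Matrix.of fun p q : Fin (n + 1) =>
      gksExpect Finset.univ K' C' (fun ω => spinAt p ω * spinAt q ω))
    (p q : Fin n) (hp : p.castSucc ∈ Finset.univ.erase (Fin.last n))
    (hq : q.castSucc ∈ Finset.univ.erase (Fin.last n)) :
    (G.submatrix (Subtype.val : ↥(Finset.univ.erase (Fin.last n)) → Fin (n + 1))
        (Subtype.val : ↥(Finset.univ.erase (Fin.last n)) → Fin (n + 1)))⁻¹
        ⟨p.castSucc, hp⟩ ⟨q.castSucc, hq⟩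
      = (Matrix.of fun p q : Fin n =>
          gksExpect Finset.univ (fun i => if i = i₀ then Kpp else K' i.castSucc) C
            (fun ω => spinAt p ω * spinAt q ω))⁻¹ p q := by
  set A : Finset (Fin (n + 1)) := Finset.univ.erase (Fin.last n) with hA
  have hmemA : ∀ z : Fin (n + 1), z ∈ A ↔ z ≠ Fin.last n := fun z => by simp [hA]
  -- the bijection `old sites ≃ A`
  obtain ⟨e, he⟩ : ∃ e : Fin n ≃ ↥A, ∀ r, (e r).1 = r.castSucc :=
    ⟨{ toFun := fun r => ⟨r.castSucc, (hmemA _).2 (Fin.castSucc_ne_last r)⟩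
       invFun := fun z => z.1.castPred ((hmemA z.1).1 z.2)
       left_inv := fun r => by simp
       right_inv := fun z => by simp }, fun r => rfl⟩
  have he' : ∀ z : ↥A, z.1 = (e.symm z).castSucc := fun z => by
    conv_lhs => rw [← e.apply_symm_apply z]
    exact he _
  have hez : ∀ (r : Fin n) (hr : r.castSucc ∈ A), e.symm ⟨r.castSucc, hr⟩ = r := by
    intro r hr
    apply e.injective
    rw [Equiv.apply_symm_apply]
    exact Subtype.ext (he r).symm
  have hsub : G.submatrix (Subtype.val : ↥A → Fin (n + 1)) (Subtype.val : ↥A → Fin (n + 1))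
      = (Matrix.of fun p q : Fin n =>
          gksExpect Finset.univ (fun i => if i = i₀ then Kpp else K' i.castSucc) C
            (fun ω => spinAt p ω * spinAt q ω)).submatrix e.symm e.symm := by
    ext z₁ z₂
    simp only [Matrix.submatrix_apply, Matrix.of_apply, hG]
    rw [he' z₁, he' z₂]
    exact spSub_marginal C i₀ a b hab hCi₀ C' hC'1 hC'2 hC'3 K' Kpp hKpp
      (fun σ => spinAt (e.symm z₁) σ * spinAt (e.symm z₂) σ)
  rw [hsub, Matrix.inv_submatrix_equiv, Matrix.submatrix_apply, hez p hp, hez q hq]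

/-- Registered helper `helper_spSub_Ablock` (representative of this auxiliary file): the old
block of the inverse-related decomposition — the inverse of the old-site block of the subdivided
second-moment matrix is the inverse of the old second-moment matrix at the series coupling
(`spSub_Ablock`). [folklore] -/
theorem helper_spSub_Ablock : ∀ (n m : ℕ) (C : Fin m → Finset (Fin n)) (i₀ : Fin m) (a b : Fin n), a ≠ b → C i₀ = {a, b} → ∀ (C' : Fin (m + 1) → Finset (Fin (n + 1))), (∀ i : Fin m, i ≠ i₀ → C' i.castSucc = (C i).map Fin.castSuccEmb) → C' i₀.castSucc = {a.castSucc, Fin.last n} → C' (Fin.last m) = {Fin.last n, b.castSucc} → ∀ (K' : Fin (m + 1) → ℝ) (p q : Fin n) (hp : p.castSucc ∈ Finset.univ.erase (Fin.last n)) (hq : q.castSucc ∈ Finset.univ.erase (Fin.last n)), ((Matrix.of fun p q : Fin (n + 1) => gksExpect Finset.univ K' C' (fun ω => spinAt p ω * spinAt q ω)).submatrix (Subtype.val : ↥(Finset.univ.erase (Fin.last n)) → Fin (n + 1)) (Subtype.val : ↥(Finset.univ.erase (Fin.last n)) → Fin (n + 1)))⁻¹ ⟨p.castSucc, hp⟩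 ⟨q.castSucc, hq⟩ = (Matrix.of fun p q : Fin n => gksExpect Finset.univ (fun i => if i = i₀ then Real.log (Real.cosh (K' i₀.castSucc + K' (Fin.last m)) / Real.cosh (K' i₀.castSucc - K' (Fin.last m))) / 2 else K' i.castSucc) C (fun ω => spinAt p ω * spinAt q ω))⁻¹ p q :=
  fun _ _ C i₀ a b hab hCi₀ C' hC'1 hC'2 hC'3 K' p q hp hq =>
    spSub_Ablock C i₀ a b hab hCi₀ C' hC'1 hC'2 hC'3 K' _ rfl _ rfl p q hp hq

end Summit.CriticalPhenomena.Ising3DConformalLimit.Cruxes.InverseMFerromagnet.PartialCovarianceLadder
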